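import Literature.Probability.LatticeModels.TorusNegTypeBochner
import HarnessLib

/-!
# Block coarse-graining of translation-invariant kernels on the finite torus

Generic bookkeeping for `b`-BLOCK kernels on the discrete torus `(ℤ/Mℤ)^d`, `M = b·m`: the block
(coarse) coordinate `β x = (⌊x_i / b⌋ mod m)_i ∈ (ℤ/mℤ)^d`, written inline everywhere as
`fun i => (((x i).val / b : ℕ) : ZMod m)` (nothing is defined), and for a kernel `K` on the fine
torus the BLOCK KERNEL `K_b(x, y) = Σ_{x' ∈ block x, y' ∈ block y} K(x', y')`, block membership being
written as in the route files of `HubbardSuperconductivity/LevyLogBootstrap`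
(`∀ i, (x' i).val / b = (x i).val / b`).

* `TorusBlock.block_iff_coarse_eq`, `…eq'` — block membership is equality of coarse coordinates;
* `TorusBlock.coarse_add_lift`, `TorusBlock.coarse_lift` — translations by `b·V` act on blocks as `+V`;
* `TorusBlock.card_filter_val_div`, `TorusBlock.card_filter_block`, `TorusBlock.sum_comp_coarse` — every
  block has `b^d` sites, so fine sums of coarse functions are `b^d ×` coarse sums;
* `TorusBlock.blockKernel_eq_coarse` — for a TRANSLATION-INVARIANT kernel `K`,
  `K_b(x, y) = k_b(β x - β y)` with the coarse kernel `k_b(X) = Σ_{β x' = X, β y' = 0} K(x', y')`;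
* `TorusBlock.coarseKernel_neg` — `k_b` is even when `K` is moreover symmetric;
* `TorusBlock.sum_comp_blockKernel_zero` — `Σ_x F(K_b(x, 0)) = b^d Σ_X F(k_b(X))` (fine Lévy-mass-type
  means are coarse means);
* `TorusBlock.isNegDefKernel_negLog_blockKernel_iff` — `-log K_b` is a negative definite kernel on the
  fine torus iff the LÉVY COEFFICIENTS `Σ_X log k_b(X) Re χ_q(X)`, `q ≠ 0` in `(ℤ/mℤ)^d`, are all
  nonnegative (Bochner on the coarse torus, `isNegDefKernel_neg_sub_iff_torusFourier_re_nonneg`,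
  pulled back along `β` and pushed forward along its section `V ↦ b·V`).

These are the `b`-general forms of the `b = 2` lemmas of
`Summits/HubbardSuperconductivity/…/Theorems/LevyLogBootstrapBlock2InfDivXXZLevyReduction.lean`
(`block2Kernel_eq_coarse`, `coarseKernel_neg`, `stub_blockLogNegType_of_levyCoeff`), so that the
infinite-divisibility ⇔ Lévy-coefficient reduction is available at every block size (the route's
foreseen `Block4InfDivXXZ` restatement). Sources: C. Berg, J. P. R. Christensen, P. Ressel (1984)
Ch. 3 Def. 1.1, Ch. 4 §3; S. Friedli, Y. Velenik (2017) §10.4. All statements are elementary and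
sorry-free; no definition is introduced.
-/

noncomputable section

open Finset Complex
open scoped BigOperators

namespace Literature.Probability.LatticeModels

open Literature.Analysis.Matrix

namespace TorusBlock

variable {d b m M : ℕ} [NeZero M] [NeZero m]

/-! ### Coarse coordinates -/

omit [NeZero m] in
/-- `M = b·m ≠ 0` forces `0 < b`. [folklore] -/
theorem pos_of_eq_mul (hM : M = b * m) : 0 < b := by
  rcases Nat.eq_zero_or_pos b with hb | hb
  · exact absurd (by rw [hM, hb, zero_mul]) (NeZero.ne M)
  · exact hb

omit [NeZero m] in
/-- Coarse components are `< m`: `⌊x_i / b⌋ < m` when `M = b·m`. [folklore] -/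
theorem val_div_lt (hM : M = b * m) (x : TorusSite d M) (i : Fin d) : (x i).val / b < m := by
  have h : (x i).val < b * m := by
    rw [← hM]
    exact ZMod.val_lt (x i)
  exact (Nat.div_lt_iff_lt_mul (pos_of_eq_mul hM)).2 (by rwa [mul_comm] at h)

omit [NeZero m] in
/-- **Block membership is equality of coarse coordinates**: for fine sites `x', x` of `(ℤ/bm)^d`,
`(∀ i, ⌊x'_i/b⌋ = ⌊x_i/b⌋) ↔ β x' = β x`, `β x = (⌊x_i/b⌋ mod m)_i`. [folklore] -/
theorem block_iff_coarse_eq (hM : M = b * m) (x' x : TorusSite d M) :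
    (∀ i : Fin d, (x' i).val / b = (x i).val / b) ↔
      (fun i : Fin d => (((x' i).val / b : ℕ) : ZMod m)) =
        fun i : Fin d => (((x i).val / b : ℕ) : ZMod m) := by
  rw [funext_iff]
  refine forall_congr' fun i => ?_
  rw [ZMod.natCast_eq_natCast_iff', Nat.mod_eq_of_lt (val_div_lt hM x' i),
    Nat.mod_eq_of_lt (val_div_lt hM x i)]

/-- Block membership relative to a coarse site `X`: `(∀ i, ⌊x'_i/b⌋ = X_i.val) ↔ β x' = X`.
[folklore] -/
theorem block_iff_coarse_eq' (hM : M = b * m) (x' : TorusSite d M) (X : TorusSite d m) :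
    (∀ i : Fin d, (x' i).val / b = (X i).val) ↔
      (fun i : Fin d => (((x' i).val / b : ℕ) : ZMod m)) = X := by
  have hX : (fun i : Fin d => (((X i).val : ℕ) : ZMod m)) = X := funext fun i => ZMod.natCast_zmod_val _
  conv_rhs => rw [← hX]
  rw [funext_iff]
  refine forall_congr' fun i => ?_
  rw [ZMod.natCast_eq_natCast_iff', Nat.mod_eq_of_lt (val_div_lt hM x' i),
    Nat.mod_eq_of_lt (ZMod.val_lt (X i))]

/-- **Translations by `b·V` act on blocks**: `β (x + bV) = β x + V`, where the fine vector `bV`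
has components `b · V_i.val`. (`⌊(a + b·v) mod bm⌋/b ≡ ⌊a/b⌋ + v (mod m)`.) [folklore] -/
theorem coarse_add_lift (hM : M = b * m) (x : TorusSite d M) (V : TorusSite d m) :
    (fun i : Fin d => ((((x + fun j => ((b * (V j).val : ℕ) : ZMod M)) i).val / b : ℕ) : ZMod m)) =
      (fun i : Fin d => (((x i).val / b : ℕ) : ZMod m)) + V := by
  have hb : 0 < b := pos_of_eq_mul hM
  subst hM
  funext i
  simp only [Pi.add_apply]
  have hval : (x i + ((b * (V i).val : ℕ) : ZMod (b * m))).val =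
      ((x i).val + b * (V i).val) % (b * m) := by
    rw [ZMod.val_add, ZMod.val_natCast, Nat.add_mod_mod]
  rw [hval, Nat.mod_mul_right_div_self, Nat.add_mul_div_left _ _ hb, ZMod.natCast_mod,
    Nat.cast_add, ZMod.natCast_zmod_val]

/-- The coarse coordinate of the fine vector `bV` is `V`: `β (bV) = V`. [folklore] -/
theorem coarse_lift (hM : M = b * m) (V : TorusSite d m) :
    (fun i : Fin d => ((((fun j => ((b * (V j).val : ℕ) : ZMod M)) i).val / b : ℕ) : ZMod m)) = V := by
  have h := coarse_add_lift hM (0 : TorusSite d M) V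
  rw [zero_add] at h
  rw [h]
  ext i
  simp [Nat.zero_div]

/-! ### Every block has `b^d` sites -/

omit [NeZero m] in
/-- For `M = b·m` and `q < m` exactly `b` residues `z ∈ ℤ/M` have block index `⌊z/b⌋ = q`, namely
`bq, bq + 1, …, bq + b - 1`. [folklore] -/
theorem card_filter_val_div (hM : M = b * m) (q : ℕ) (hq : q < m) :
    (Finset.univ.filter (fun z : ZMod M => z.val / b = q)).card = b := by
  classical
  have hb : 0 < b := pos_of_eq_mul hM
  have hbq : b * q + b ≤ M := by
    rw [hM]
    calc b * q + b = b * (q + 1) := by ring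
      _ ≤ b * m := Nat.mul_le_mul_left b hq
  have hset : Finset.univ.filter (fun z : ZMod M => z.val / b = q) =
      (Finset.range b).image (fun n => ((b * q + n : ℕ) : ZMod M)) := by
    ext z
    simp only [Finset.mem_filter, Finset.mem_univ, true_and, Finset.mem_image, Finset.mem_range]
    constructor
    · intro hz
      have h1 : b * q ≤ z.val := by
        have := (Nat.le_div_iff_mul_le hb).1 hz.ge
        rwa [mul_comm] at this
      have h2 : z.val < b * q + b := by
        have := (Nat.div_lt_iff_lt_mul hb).1 (hz.le.trans_lt (Nat.lt_succ_self q))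
        rw [Nat.succ_mul] at this
        rwa [mul_comm] at this
      refine ⟨z.val - b * q, by omega, ?_⟩
      rw [show b * q + (z.val - b * q) = z.val by omega, ZMod.natCast_zmod_val]
    · rintro ⟨n, hn, rfl⟩
      rw [ZMod.val_natCast_of_lt (by omega), Nat.mul_add_div hb, Nat.div_eq_of_lt hn, add_zero]
  rw [hset, Finset.card_image_of_injOn, Finset.card_range]
  intro n₁ hn₁ n₂ hn₂ h
  have h1 : b * q + n₁ < M := by simp only [Finset.coe_range, Set.mem_Iio] at hn₁; omega
  have h2 : b * q + n₂ < M := by simp only [Finset.coe_range, Set.mem_Iio] at hn₂; omega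
  have := congrArg ZMod.val h
  rw [ZMod.val_natCast_of_lt h1, ZMod.val_natCast_of_lt h2] at this
  omega

/-- **Every `b`-block of `(ℤ/bm)^d` has exactly `b^d` sites.** [folklore] -/
theorem card_filter_block (hM : M = b * m) (X : TorusSite d m) :
    (Finset.univ.filter (fun x : TorusSite d M => ∀ i : Fin d, (x i).val / b = (X i).val)).card =
      b ^ d := by
  classical
  have hset : Finset.univ.filter (fun x : TorusSite d M => ∀ i : Fin d, (x i).val / b = (X i).val) =
      Fintype.piFinset (fun i => Finset.univ.filter (fun z : ZMod M => z.val / b = (X i).val)) := by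
    ext x
    simp only [Finset.mem_filter, Finset.mem_univ, true_and, Fintype.mem_piFinset]
  rw [hset, Fintype.card_piFinset]
  simp_rw [card_filter_val_div hM _ (ZMod.val_lt (X _))]
  rw [Finset.prod_const, Finset.card_univ, Fintype.card_fin]

/-- **Fine sums of coarse functions**: `Σ_{x ∈ (ℤ/bm)^d} F(β x) = b^d · Σ_{X ∈ (ℤ/m)^d} F(X)`.
[folklore] -/
theorem sum_comp_coarse (hM : M = b * m) (F : TorusSite d m → ℝ) :
    ∑ x : TorusSite d M, F (fun i : Fin d => (((x i).val / b : ℕ) : ZMod m)) =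
      (b : ℝ) ^ d * ∑ X : TorusSite d m, F X := by
  classical
  set β : TorusSite d M → TorusSite d m := fun x i => (((x i).val / b : ℕ) : ZMod m) with hβ
  rw [← Finset.sum_fiberwise_of_maps_to (s := univ) (t := univ) (g := β) (fun x _ => mem_univ _),
    Finset.mul_sum]
  refine Finset.sum_congr rfl fun X _ => ?_
  have hconst : ∑ x ∈ univ.filter (fun x => β x = X), F (β x) =
      ∑ x ∈ univ.filter (fun x => β x = X), F X :=
    Finset.sum_congr rfl fun x hx => by rw [(Finset.mem_filter.1 hx).2]
  rw [hconst, Finset.sum_const, nsmul_eq_mul]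
  have hflt : univ.filter (fun x : TorusSite d M => β x = X) =
      univ.filter (fun x : TorusSite d M => ∀ i : Fin d, (x i).val / b = (X i).val) := by
    refine Finset.filter_congr fun x _ => ?_
    rw [hβ]
    exact (block_iff_coarse_eq' hM x X).symm
  rw [hflt, card_filter_block hM X]
  push_cast
  ring

/-! ### Block kernels of translation-invariant kernels factor through the coarse torus -/

/-- **Factorisation of the block kernel through the coarse torus.** For `M = b·m` and a
TRANSLATION-INVARIANT kernel `K` on `(ℤ/Mℤ)^d`, the fine-indexed block kernel equals the coarse
block kernel at the difference of the block coordinates: `K_b(x, y) = k_b(β x - β y)`,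
`k_b(X) = Σ_{β x' = X, β y' = 0} K(x', y')` — shift both summation variables by `b·β y`.
[folklore] -/
theorem blockKernel_eq_coarse (hM : M = b * m) (K : TorusSite d M → TorusSite d M → ℝ)
    (hT : ∀ v x y : TorusSite d M, K (x + v) (y + v) = K x y) (x y : TorusSite d M) :
    (∑ x' : TorusSite d M, ∑ y' : TorusSite d M,
      if (∀ i : Fin d, (x' i).val / b = (x i).val / b) ∧ (∀ i : Fin d, (y' i).val / b = (y i).val / b)
      then K x' y' else 0) =
    ∑ x' : TorusSite d M, ∑ y' : TorusSite d M,
      if (∀ i : Fin d, (x' i).val / b =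
            (((fun i : Fin d => (((x i).val / b : ℕ) : ZMod m)) -
              fun i : Fin d => (((y i).val / b : ℕ) : ZMod m)) i).val) ∧
          (∀ i : Fin d, (y' i).val / b = 0)
      then K x' y' else 0 := by
  classical
  set β : TorusSite d M → TorusSite d m := fun z i => (((z i).val / b : ℕ) : ZMod m) with hβ
  set w : TorusSite d M := fun j => ((b * (β y j).val : ℕ) : ZMod M) with hw
  have hshift : ∀ a : TorusSite d M, β (a + w) = β a + β y := fun a => coarse_add_lift hM a (β y)
  have hL : ∀ a c : TorusSite d M,
      ((∀ i : Fin d, (a i).val / b = (x i).val / b) ∧ (∀ i : Fin d, (c i).val / b = (y i).val / b)) ↔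
        (β a = β x ∧ β c = β y) := fun a c => by
    rw [block_iff_coarse_eq hM a x, block_iff_coarse_eq hM c y]
  have hzero : ∀ c : TorusSite d M, (∀ i : Fin d, (c i).val / b = 0) ↔ β c = 0 := fun c => by
    have := block_iff_coarse_eq' hM c (0 : TorusSite d m)
    simpa only [Pi.zero_apply, ZMod.val_zero] using this
  have hR : ∀ a c : TorusSite d M,
      ((∀ i : Fin d, (a i).val / b = ((β x - β y) i).val) ∧ (∀ i : Fin d, (c i).val / b = 0)) ↔
        (β a = β x - β y ∧ β c = 0) := fun a c => by
    rw [block_iff_coarse_eq' hM a (β x - β y), hzero c]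
  calc (∑ x' : TorusSite d M, ∑ y' : TorusSite d M,
        if (∀ i : Fin d, (x' i).val / b = (x i).val / b) ∧ (∀ i : Fin d, (y' i).val / b = (y i).val / b)
        then K x' y' else 0)
      = ∑ x' : TorusSite d M, ∑ y' : TorusSite d M,
          if β x' = β x ∧ β y' = β y then K x' y' else 0 := by
        refine Finset.sum_congr rfl fun a _ => Finset.sum_congr rfl fun c _ => ?_
        rw [if_congr (hL a c) rfl rfl]
    _ = ∑ a : TorusSite d M, ∑ c : TorusSite d M,
          if β (a + w) = β x ∧ β (c + w) = β y then K (a + w) (c + w) else 0 := by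
        rw [← Equiv.sum_comp (Equiv.addRight w)]
        refine Finset.sum_congr rfl fun a _ => ?_
        rw [← Equiv.sum_comp (Equiv.addRight w)]
        rfl
    _ = ∑ a : TorusSite d M, ∑ c : TorusSite d M,
          if β a = β x - β y ∧ β c = 0 then K a c else 0 := by
        refine Finset.sum_congr rfl fun a _ => Finset.sum_congr rfl fun c _ => ?_
        have h1 : (β (a + w) = β x ∧ β (c + w) = β y) ↔ (β a = β x - β y ∧ β c = 0) := by
          rw [hshift a, hshift c, eq_sub_iff_add_eq, add_eq_right]
        rw [if_congr h1 (hT w a c) rfl]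
    _ = _ := by
        refine Finset.sum_congr rfl fun a _ => Finset.sum_congr rfl fun c _ => ?_
        rw [if_congr (hR a c) rfl rfl]

/-- **The coarse block kernel of a symmetric translation-invariant kernel is even**:
`k_b(-X) = k_b(X)` — swap the two summation variables and shift both by `b·X`. [folklore] -/
theorem coarseKernel_neg (hM : M = b * m) (K : TorusSite d M → TorusSite d M → ℝ)
    (hT : ∀ v x y : TorusSite d M, K (x + v) (y + v) = K x y) (hS : ∀ x y : TorusSite d M, K x y = K y x)
    (X : TorusSite d m) :
    (∑ x' : TorusSite d M, ∑ y' : TorusSite d M,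
      if (∀ i : Fin d, (x' i).val / b = ((-X) i).val) ∧ (∀ i : Fin d, (y' i).val / b = 0)
      then K x' y' else 0) =
    ∑ x' : TorusSite d M, ∑ y' : TorusSite d M,
      if (∀ i : Fin d, (x' i).val / b = (X i).val) ∧ (∀ i : Fin d, (y' i).val / b = 0)
      then K x' y' else 0 := by
  classical
  set β : TorusSite d M → TorusSite d m := fun z i => (((z i).val / b : ℕ) : ZMod m) with hβ
  set w : TorusSite d M := fun j => ((b * (X j).val : ℕ) : ZMod M) with hw
  have hshift : ∀ a : TorusSite d M, β (a + w) = β a + X := fun a => coarse_add_lift hM a X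
  have hzero : ∀ c : TorusSite d M, (∀ i : Fin d, (c i).val / b = 0) ↔ β c = 0 := fun c => by
    have := block_iff_coarse_eq' hM c (0 : TorusSite d m)
    simpa only [Pi.zero_apply, ZMod.val_zero] using this
  have hL : ∀ a c : TorusSite d M,
      ((∀ i : Fin d, (a i).val / b = ((-X) i).val) ∧ (∀ i : Fin d, (c i).val / b = 0)) ↔
        (β a = -X ∧ β c = 0) := fun a c => by rw [block_iff_coarse_eq' hM a (-X), hzero c]
  have hR : ∀ a c : TorusSite d M,
      ((∀ i : Fin d, (a i).val / b = (X i).val) ∧ (∀ i : Fin d, (c i).val / b = 0)) ↔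
        (β a = X ∧ β c = 0) := fun a c => by rw [block_iff_coarse_eq' hM a X, hzero c]
  symm
  calc (∑ x' : TorusSite d M, ∑ y' : TorusSite d M,
        if (∀ i : Fin d, (x' i).val / b = (X i).val) ∧ (∀ i : Fin d, (y' i).val / b = 0)
        then K x' y' else 0)
      = ∑ a : TorusSite d M, ∑ c : TorusSite d M, if β a = X ∧ β c = 0 then K a c else 0 := by
        refine Finset.sum_congr rfl fun a _ => Finset.sum_congr rfl fun c _ => ?_
        rw [if_congr (hR a c) rfl rfl]
    _ = ∑ c : TorusSite d M, ∑ a : TorusSite d M, if β a = X ∧ β c = 0 then K a c else 0 :=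
        Finset.sum_comm
    _ = ∑ c : TorusSite d M, ∑ a : TorusSite d M,
          if β (a + w) = X ∧ β (c + w) = 0 then K (a + w) (c + w) else 0 := by
        rw [← Equiv.sum_comp (Equiv.addRight w)]
        refine Finset.sum_congr rfl fun c _ => ?_
        rw [← Equiv.sum_comp (Equiv.addRight w)]
        rfl
    _ = ∑ c : TorusSite d M, ∑ a : TorusSite d M, if β c = -X ∧ β a = 0 then K c a else 0 := by
        refine Finset.sum_congr rfl fun c _ => Finset.sum_congr rfl fun a _ => ?_
        have h1 : (β (a + w) = X ∧ β (c + w) = 0) ↔ (β c = -X ∧ β a = 0) := by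
          rw [hshift a, hshift c, add_eq_right, add_eq_zero_iff_eq_neg, and_comm]
        rw [if_congr h1 ((hT w a c).trans (hS a c)) rfl]
    _ = _ := by
        refine Finset.sum_congr rfl fun a _ => Finset.sum_congr rfl fun c _ => ?_
        rw [if_congr (hL a c) rfl rfl]

/-- **The block kernel against the origin is the coarse kernel at the block coordinate**:
`K_b(x, 0) = k_b(β x)` (translation-invariant `K`). [folklore] -/
theorem blockKernel_zero_eq_coarse (hM : M = b * m) (K : TorusSite d M → TorusSite d M → ℝ)
    (hT : ∀ v x y : TorusSite d M, K (x + v) (y + v) = K x y) (x : TorusSite d M) :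
    (∑ x' : TorusSite d M, ∑ y' : TorusSite d M,
      if (∀ i : Fin d, (x' i).val / b = (x i).val / b) ∧
          (∀ i : Fin d, (y' i).val / b = ((0 : TorusSite d M) i).val / b)
      then K x' y' else 0) =
    ∑ x' : TorusSite d M, ∑ y' : TorusSite d M,
      if (∀ i : Fin d, (x' i).val / b = ((fun i : Fin d => (((x i).val / b : ℕ) : ZMod m)) i).val) ∧
          (∀ i : Fin d, (y' i).val / b = 0)
      then K x' y' else 0 := by
  rw [blockKernel_eq_coarse hM K hT x 0]
  have h0 : (fun i : Fin d => ((((0 : TorusSite d M) i).val / b : ℕ) : ZMod m)) = 0 := by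
    funext i
    simp [Nat.zero_div]
  rw [h0, sub_zero]

/-- **Fine means over the block kernel are coarse means**: for translation-invariant `K` and any
`F : ℝ → ℝ`, `Σ_x F(K_b(x, 0)) = b^d · Σ_X F(k_b(X))` — e.g. the fine-torus Lévy mass
`M^{-d} Σ_x -log(K_b(x,0)/K_b(0,0))` is the coarse mean `m^{-d} Σ_X (log k_b(0) - log k_b(X))`.
[folklore] -/
theorem sum_comp_blockKernel_zero (hM : M = b * m) (K : TorusSite d M → TorusSite d M → ℝ)
    (hT : ∀ v x y : TorusSite d M, K (x + v) (y + v) = K x y) (F : ℝ → ℝ) :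
    ∑ x : TorusSite d M, F (∑ x' : TorusSite d M, ∑ y' : TorusSite d M,
      if (∀ i : Fin d, (x' i).val / b = (x i).val / b) ∧
          (∀ i : Fin d, (y' i).val / b = ((0 : TorusSite d M) i).val / b)
      then K x' y' else 0) =
    (b : ℝ) ^ d * ∑ X : TorusSite d m, F (∑ x' : TorusSite d M, ∑ y' : TorusSite d M,
      if (∀ i : Fin d, (x' i).val / b = (X i).val) ∧ (∀ i : Fin d, (y' i).val / b = 0)
      then K x' y' else 0) := by
  simp_rw [blockKernel_zero_eq_coarse hM K hT]
  exact sum_comp_coarse hM (fun X => F (∑ x' : TorusSite d M, ∑ y' : TorusSite d M,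
      if (∀ i : Fin d, (x' i).val / b = (X i).val) ∧ (∀ i : Fin d, (y' i).val / b = 0)
      then K x' y' else 0))

/-! ### Negative type of `-log K_b` ⇔ nonnegative Lévy coefficients -/

/-- **`-log K_b` is of negative type iff the Lévy coefficients are nonnegative.** For `M = b·m`,
a symmetric translation-invariant kernel `K` on `(ℤ/Mℤ)^d` with block kernel `K_b` and coarse
kernel `k_b`: the fine kernel `(x, y) ↦ -log K_b(x, y)` is negative definite iff for every nonzero
coarse momentum `q ∈ (ℤ/mℤ)^d` the Lévy coefficient `Σ_X log k_b(X) Re χ_q(X)` is nonnegative.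
(`K_b(x,y) = k_b(β x - β y)` and `k_b` is even, so (⇐) is Bochner on the coarse torus pulled back
along `β` (`isNegDefKernel_neg_of_factor_torus`); for (⇒) pull the fine kernel back along the
section `V ↦ b·V` of `β` and apply `torusFourier_re_nonneg_of_isNegDefKernel_neg_sub`.) By
Schoenberg's theorem this is infinite divisibility of the (entrywise positive) block kernel.
Berg–Christensen–Ressel (1984) Ch. 3 §2, Ch. 4 §3. [cite: BergChristensenRessel1984, Ch. 4 §3] -/
theorem isNegDefKernel_negLog_blockKernel_iff (hM : M = b * m)
    (K : TorusSite d M → TorusSite d M → ℝ)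
    (hT : ∀ v x y : TorusSite d M, K (x + v) (y + v) = K x y) (hS : ∀ x y : TorusSite d M, K x y = K y x) :
    IsNegDefKernel (fun x y : TorusSite d M => -Real.log (∑ x' : TorusSite d M, ∑ y' : TorusSite d M,
        if (∀ i : Fin d, (x' i).val / b = (x i).val / b) ∧ (∀ i : Fin d, (y' i).val / b = (y i).val / b)
        then K x' y' else 0)) ↔
      ∀ q : TorusSite d m, q ≠ 0 →
        0 ≤ ∑ X : TorusSite d m, Real.log (∑ x' : TorusSite d M, ∑ y' : TorusSite d M,
          if (∀ i : Fin d, (x' i).val / b = (X i).val) ∧ (∀ i : Fin d, (y' i).val / b = 0)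
          then K x' y' else 0) * (torusChar q X).re := by
  classical
  set k : TorusSite d m → ℝ := fun X => ∑ x' : TorusSite d M, ∑ y' : TorusSite d M,
      if (∀ i : Fin d, (x' i).val / b = (X i).val) ∧ (∀ i : Fin d, (y' i).val / b = 0)
      then K x' y' else 0 with hk
  set β : TorusSite d M → TorusSite d m := fun z i => (((z i).val / b : ℕ) : ZMod m) with hβ
  -- factorisation and evenness
  have hfac : ∀ x y : TorusSite d M, (∑ x' : TorusSite d M, ∑ y' : TorusSite d M,
      if (∀ i : Fin d, (x' i).val / b = (x i).val / b) ∧ (∀ i : Fin d, (y' i).val / b = (y i).val / b)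
      then K x' y' else 0) = k (β x - β y) := fun x y => by
    rw [blockKernel_eq_coarse hM K hT x y]
  have heven : ∀ X, k (-X) = k X := fun X => by
    simp only [hk]
    exact coarseKernel_neg hM K hT hS X
  have hlogeven : ∀ X, Real.log (k (-X)) = Real.log (k X) := fun X => by rw [heven]
  constructor
  · intro h q hq
    -- pull back along the section `V ↦ bV`
    set s : TorusSite d m → TorusSite d M := fun V j => ((b * (V j).val : ℕ) : ZMod M) with hs
    have hβs : ∀ V, β (s V) = V := fun V => coarse_lift hM V
    have h' := h.comp_fun s
    have hND : IsNegDefKernel fun X Y : TorusSite d m => -Real.log (k (X - Y)) := by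
      refine ⟨fun X Y => ?_, fun n x c hc => ?_⟩
      · show -Real.log (k (X - Y)) = -Real.log (k (Y - X))
        rw [← hlogeven (X - Y), neg_sub]
      · have := h'.2 n x c hc
        simpa only [hfac, hβs] using this
    exact torusFourier_re_nonneg_of_isNegDefKernel_neg_sub (fun X => Real.log (k X)) hND q hq
  · intro hν
    exact isNegDefKernel_neg_of_factor_torus (d := d) (L := m) _ β (fun X => Real.log (k X))
      (fun x y => by rw [hfac x y]) hlogeven hν

end TorusBlock

end Literature.Probability.LatticeModels

end
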